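import Summits.BirchSwinnertonDyer.BirchSwinnertonDyer.Theorems.CyclotomicUntwistKatzRankSupersingular
import Summits.BirchSwinnertonDyer.BirchSwinnertonDyer.Theorems.CyclotomicUntwistFormalEndomorphismPadicDigits
import HarnessLib

/-!
# Stub `S2k` = `stub_KATZ_rankLeTwo_supersingular` of the K-SEP skeletons (Lines/dfrob_wan v3 on K1 =
# stmt-BirchSwinnertonDyer-21580, Lines/dfrob_kato v3 on K2 = 21581; lead cycu-p1 g6) — LANDED BY NAME

Cell `pub/bsd-wall` (D-0145 line `route-BirchSwinnertonDyer-CyclotomicUntwist`), width seat `bsd-line-cycu-p4` (gen 8). The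
supersingular special case of Katz's rank statement (Literature `katz_dieudonne_rank_le_two`, Katz 1981 Thm 5.3.3) for
Weierstrass models over `𝓞 = 𝓞_{ℚ₃(ζ₉)}` — the print input of the K-SEP child C2 — is a THEOREM, by the elementary route of
cycu-p3 g8's memo `KATZ-FROBENIUS-MOD-VARPI-v2`: W1 Honda's step (cycu-p3, `SecondKindLog`), W2 Lemma Λ (cycu-p4,
`FormalLogDivisibility`), W3 the digit expansion of `End_{𝔽₃⟦X⟧}(F̄)` (cycu-p3 `FormalEndomorphismFrobenius`, cycu-p2 g7
`FormalEndomorphismDigits` / `FormalEndomorphismPadicDigits`), the lead's `PadicRankTwoAssembly` (B1), the bridge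
`PadicDigitLimit` and the base change `NineIntegralCoordinates` / `KatzRankBaseChange` / `KatzRankSupersingular` (cycu-p4).
THEOREMS ONLY; `--supports` stmt-BirchSwinnertonDyer-21580. BSD is not proved by this file; K1/K2 stay open (C1/C4/C5 research).
[cite: Katz1981CrystallineDieudonne, Thm. 5.3.3]
-/

set_option autoImplicit false
-- single-conjunct summit: `Summit.BirchSwinnertonDyer.BirchSwinnertonDyer.…` repeats the name by design
set_option linter.dupNamespace false

noncomputable section

open Literature.NumberTheory.EllipticCurves.DescendedFrobenius
  Summit.BirchSwinnertonDyer.BirchSwinnertonDyer.Theorems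

namespace Summit.BirchSwinnertonDyer.BirchSwinnertonDyer.Cruxes.PSRankOneLowerHalfAtThree.DFrob

/-- **Stub `S2k` (registered, VERBATIM): Katz's rank `≤ 2` for Weierstrass models over `𝓞_{ℚ₃(ζ₉)}` with elliptic
SUPERSINGULAR special fibre** — any three second-kind series are `ℚ₃(ζ₉)`-dependent modulo bounded denominators.
Proof: `KatzRankSupersingular.stub_KATZ_rankLeTwo_supersingular_of_digits` over cycu-p2 g7's digit theorem
`FormalEndomorphismPadicDigits.exists_digits_of_map_toZMod_hom`. [cite: Katz1981CrystallineDieudonne, Thm. 5.3.3] -/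
theorem stub_KATZ_rankLeTwo_supersingular :
    ∀ (E : WeierstrassCurve ONine) (ρ : ONine →+* ZMod 3), IsUnit (E.map ρ).Δ →
      (3 : ℤ) ∣ Literature.NumberTheory.EllipticCurves.HasseManin.tr (E.map ρ) →
      ∀ f : Fin 3 → PowerSeries KNine,
        (∀ i, PowerSeries.constantCoeff (f i) = 0 ∧
          (∃ d : ℕ, ∀ n : ℕ, _root_.IsIntegral ℤ_[3] ((3 : KNine) ^ d * ((n : KNine) * PowerSeries.coeff n (f i)))) ∧
          (∃ d' : ℕ, ∀ e : Fin 2 →₀ ℕ, _root_.IsIntegral ℤ_[3] ((3 : KNine) ^ d' * MvPowerSeries.coeff e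
            ((f i).subst (E.map (algebraMap ONine KNine)).formalGroupLaw - (f i).subst (MvPowerSeries.X 0) -
              (f i).subst (MvPowerSeries.X 1))))) →
        ∃ a : Fin 3 → KNine, a ≠ 0 ∧ HasBoundedDenominators (∑ i, PowerSeries.C (a i) * f i) :=
  KatzRankSupersingular.stub_KATZ_rankLeTwo_supersingular_of_digits
    (fun V₀ _ _ hV₀ => FormalEndomorphismPadicDigits.exists_digits_of_map_toZMod_hom V₀ hV₀)

end Summit.BirchSwinnertonDyer.BirchSwinnertonDyer.Cruxes.PSRankOneLowerHalfAtThree.DFrob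

end
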